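import Summits.BirchSwinnertonDyer.BirchSwinnertonDyer.Theorems.AdditiveKolyvaginRoadLevelSystemsRigidityDichotomy
import HarnessLib

/-!
# Route `AdditiveKolyvaginRoad`, crux `LevelKolyvaginSystemsAdditive` (item stmt-BirchSwinnertonDyer-21396, KS′):
# the SYNTHETIC Kolyvagin family of a two-sign Selmer ladder — abstract linear algebra
# (cell `pub/bsd-wall`, lead prover `cruxlead-stmt-BirchSwinnertonDyer-21396` g2; `--supports stmt-BirchSwinnertonDyer-21396`,
# helper; part 1 of 2, feeding `…LevelSystemsOfSelmerDichotomy` (the carrier `LevelKolyvaginSystemP` from KPA′-at-frame))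

WHY. The carrier `LevelKolyvaginSystemP W K p Dt β ι c` of crux KS′ (`…LevelSystems`) pins GENUINE Kolyvagin classes only at
the level `n = ∅` (`realisation`); at every NON-EMPTY level its fields (`sign`, `selmer_off`, `selmer_inf`, `toric_on`,
`transverse_on`, `relation`, `baseCase`) constrain the classes `κ m n` only through the LEVEL-`n` SELMER STRUCTURES with the
TRANSVERSE condition at the Kolyvagin primes of `m`; the one bridge between the two is `transport` at the bottom level, whose
conclusion `∃ m, κ m ∅ ≠ 0` is the conclusion of the route's target KPA′ at the frame. This file isolates the linear algebra
that SYNTHESISES, at one level, a family `m ↦ κ m` with all the `m`-direction axioms from the E-side DICHOTOMY at the Kolyvagin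
primes alone (Mazur–Rubin's «how to use Kolyvagin primes», W. Zhang Lemma 8.2 ∕ 8.4 shape): no Heegner point, no level-raised
form, no reciprocity law, no rank-0 anchor enters.

WHAT (abstract: `F` a field, `H` an `F`-space, `L` an index type of «Kolyvagin primes»; `Sel m μ ≤ H` the `μ`-eigen Selmer space
TRANSVERSE on `m`; `Z ℓ ≤ H` the classes locally trivial above `ℓ`; hypotheses (Lower) ∕ (Raise) = the dichotomy when one
Kolyvagin prime is added to the transverse set, (Out) = descent of a locally trivial class, finite-dimensionality):
* `bodd_finrank_eq` — PARITY: `dim Sel m μ ≡ dim Sel ∅ μ + #m (mod 2)` (each added prime moves each sign by `±1`).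
* `exists_synthetic` — the SYNTHETIC FAMILY: `κ m :=` a generator of `Sel m ⁺ ⊕ Sel m ⁻` when its total dimension is `1`, else
  `0`, and `ε₀ :=` the parity of `dim Sel ∅ ⁺`, satisfy: `κ m ∈ Sel m (ε₀ ^^ bodd #m)` (SIGN coherence, from the parity);
  `κ m ≠ 0 ⟺` total dimension of level `m` is `1`; and the carrier's RELATION `κ(m ∪ ℓ) ∈ Z ℓ ⟺ κ m ∈ Z ℓ` for `ℓ ∉ m` (a
  case analysis on the dichotomy: detected generator ⟹ the rank-one line moves to the other sign with a generator NOT in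
  `Z ℓ`; undetected generator ⟹ total dimension `3`; total dimension `≠ 1` below and `= 1` above forces the generator above
  into `Z ℓ`).

HONEST FRAMING: theorems only; 0 definitions, 0 named facts, 0 `sorry`; (Lower) ∕ (Raise) ∕ (Out) are HYPOTHESES; pure linear
algebra; closes nothing. BSD is not proved by any of this.

References: [cite: MazurRubin2004, Lemma 4.1.7, Prop. 4.5.8] [cite: WZhang2014, §8.1, Lemma 8.2, Lemma 8.4, (8.1)]
[cite: Howard2006Bipartite, Cor. 2.3.5] [cite: GrossLMS1991, Prop. 6.2].
-/

-- single-conjunct summit: `Summit.BirchSwinnertonDyer.BirchSwinnertonDyer.…` repeats the name by design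
set_option linter.dupNamespace false

noncomputable section

open scoped Classical

namespace Summit.BirchSwinnertonDyer.BirchSwinnertonDyer.Theorems.AdditiveKoly.Synthetic

open Module Summit.BirchSwinnertonDyer.Rank1Residual.X11b.Three.Koly.CoreGraph

variable {F : Type*} [Field F] {H : Type*} [AddCommGroup H] [Module F H] {L : Type*} [DecidableEq L]
  (Sel : Finset L → Bool → Submodule F H) (Z : L → Submodule F H)

/-- **Parity under the Kolyvagin dichotomy**: if adding one prime `ℓ ∉ m` to the transverse set moves `dim Sel · μ` by exactly
`−1` (some class of `Sel m μ` is detected above `ℓ`) or `+1` (none is), then `bodd (dim Sel m μ) = bodd (dim Sel ∅ μ) ^^ bodd #m`.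
[cite: MazurRubin2004, Lemma 4.1.7] [cite: Howard2006Bipartite, Cor. 2.3.5] -/
theorem bodd_finrank_eq
    (hLower : ∀ (m : Finset L) (ℓ : L) (μ : Bool), ℓ ∉ m → (∃ x ∈ Sel m μ, x ∉ Z ℓ) →
      Sel (insert ℓ m) μ ≤ Z ℓ ∧ finrank F (Sel (insert ℓ m) μ) + 1 = finrank F (Sel m μ))
    (hRaise : ∀ (m : Finset L) (ℓ : L) (μ : Bool), ℓ ∉ m → (∀ x ∈ Sel m μ, x ∈ Z ℓ) →
      finrank F (Sel (insert ℓ m) μ) = finrank F (Sel m μ) + 1)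
    (m : Finset L) (μ : Bool) :
    Nat.bodd (finrank F (Sel m μ)) = (Nat.bodd (finrank F (Sel ∅ μ)) ^^ Nat.bodd m.card) := by
  induction m using Finset.induction_on with
  | empty => simp only [Finset.card_empty, Nat.bodd_zero, Bool.xor_false]
  | insert ℓ m hℓm ih =>
    rw [Finset.card_insert_of_notMem hℓm, Nat.bodd_succ, Bool.xor_not, ← ih]
    by_cases hx : ∃ x ∈ Sel m μ, x ∉ Z ℓ
    · obtain ⟨-, hrank⟩ := hLower m ℓ μ hℓm hx
      rw [← hrank, Nat.bodd_succ, Bool.not_not]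
    · push Not at hx
      rw [hRaise m ℓ μ hℓm hx, Nat.bodd_succ]

/-- **The synthetic Kolyvagin family of a two-sign Selmer ladder.** Under the Kolyvagin dichotomy (Lower) ∕ (Raise), the
descent (Out) of locally trivial classes and finite-dimensionality, there are a sign `ε₀` and classes `κ m ∈ Sel m (ε₀ ^^ bodd #m)`
(one per finite transverse set `m`) with `κ m ≠ 0 ⟺ dim Sel m ⁺ + dim Sel m ⁻ = 1` and the carrier's RELATION
`κ (m ∪ ℓ) ∈ Z ℓ ⟺ κ m ∈ Z ℓ` (`ℓ ∉ m`). Construction: `κ m :=` a generator of the rank-one level (else `0`), `ε₀ := bodd (dim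
Sel ∅ ⁺)`. This is the `m`-direction of a level Kolyvagin system WITHOUT any Heegner ∕ level-raised input.
[cite: MazurRubin2004, Lemma 4.1.7, Prop. 4.5.8] [cite: WZhang2014, Lemma 8.2, Lemma 8.4, (8.1)] -/
theorem exists_synthetic
    (hfin : ∀ (m : Finset L) (μ : Bool), Module.Finite F (Sel m μ))
    (hLower : ∀ (m : Finset L) (ℓ : L) (μ : Bool), ℓ ∉ m → (∃ x ∈ Sel m μ, x ∉ Z ℓ) →
      Sel (insert ℓ m) μ ≤ Z ℓ ∧ finrank F (Sel (insert ℓ m) μ) + 1 = finrank F (Sel m μ))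
    (hRaise : ∀ (m : Finset L) (ℓ : L) (μ : Bool), ℓ ∉ m → (∀ x ∈ Sel m μ, x ∈ Z ℓ) →
      finrank F (Sel (insert ℓ m) μ) = finrank F (Sel m μ) + 1)
    (hOut : ∀ (m : Finset L) (ℓ : L) (μ : Bool), ℓ ∉ m → ∀ z ∈ Sel (insert ℓ m) μ, z ∈ Z ℓ → z ∈ Sel m μ) :
    ∃ (ε₀ : Bool) (κ : Finset L → H),
      (∀ m, κ m ∈ Sel m (ε₀ ^^ Nat.bodd m.card)) ∧
      (∀ m, κ m ≠ 0 ↔ finrank F (Sel m true) + finrank F (Sel m false) = 1) ∧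
      (∀ (m : Finset L) (ℓ : L), ℓ ∉ m → (κ (insert ℓ m) ∈ Z ℓ ↔ κ m ∈ Z ℓ)) := by
  -- generator data at the levels of total rank one
  have hgen : ∀ m : Finset L, finrank F (Sel m true) + finrank F (Sel m false) = 1 →
      ∃ (μ : Bool) (s : H), finrank F (Sel m μ) = 1 ∧ Sel m (!μ) = ⊥ ∧ s ∈ Sel m μ ∧ s ≠ 0 ∧
        ∀ y ∈ Sel m μ, ∃ c : F, c • s = y :=
    fun m h ↦ exists_generator_of_total_eq_one Sel hfin h
  let μof : Finset L → Bool := fun m ↦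
    if h : finrank F (Sel m true) + finrank F (Sel m false) = 1 then (hgen m h).choose else false
  let κ : Finset L → H := fun m ↦
    if h : finrank F (Sel m true) + finrank F (Sel m false) = 1 then (hgen m h).choose_spec.choose else 0
  have hκ1 : ∀ m, finrank F (Sel m true) + finrank F (Sel m false) = 1 →
      finrank F (Sel m (μof m)) = 1 ∧ Sel m (!μof m) = ⊥ ∧ κ m ∈ Sel m (μof m) ∧ κ m ≠ 0 ∧
        ∀ y ∈ Sel m (μof m), ∃ c : F, c • κ m = y := by
    intro m h
    have hμ : μof m = (hgen m h).choose := dif_pos h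
    have hκ : κ m = (hgen m h).choose_spec.choose := dif_pos h
    rw [hμ, hκ]
    exact (hgen m h).choose_spec.choose_spec
  have hκ0 : ∀ m, finrank F (Sel m true) + finrank F (Sel m false) ≠ 1 → κ m = 0 := fun m h ↦ dif_neg h
  -- the other sign is locally trivial everywhere (it is zero)
  have hbot_triv : ∀ m (ℓ : L), finrank F (Sel m true) + finrank F (Sel m false) = 1 →
      ∀ x ∈ Sel m (!μof m), x ∈ Z ℓ := by
    intro m ℓ h x hx
    rw [(hκ1 m h).2.1] at hx
    rw [(Submodule.mem_bot F).mp hx]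
    exact Submodule.zero_mem _
  -- the rank-one sign is the parity sign
  have hsign : ∀ m, finrank F (Sel m true) + finrank F (Sel m false) = 1 →
      μof m = (Nat.bodd (finrank F (Sel ∅ true)) ^^ Nat.bodd m.card) := by
    intro m h
    obtain ⟨h1, hbot, -, -, -⟩ := hκ1 m h
    rw [← bodd_finrank_eq Sel Z hLower hRaise m true]
    rcases Bool.eq_false_or_eq_true (μof m) with hμ | hμ
    · rw [hμ] at h1
      rw [hμ, h1]
      rfl
    · rw [hμ, Bool.not_false] at hbot
      rw [hμ, hbot, finrank_bot]
      rfl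
  refine ⟨Nat.bodd (finrank F (Sel ∅ true)), κ, fun m ↦ ?_, fun m ↦ ?_, fun m ℓ hℓm ↦ ?_⟩
  · -- membership with the parity sign
    by_cases h : finrank F (Sel m true) + finrank F (Sel m false) = 1
    · rw [← hsign m h]
      exact (hκ1 m h).2.2.1
    · rw [hκ0 m h]
      exact Submodule.zero_mem _
  · -- non-vanishing iff total rank one
    refine ⟨fun hne ↦ ?_, fun h ↦ (hκ1 m h).2.2.2.1⟩
    by_contra h
    exact hne (hκ0 m h)
  · -- the relation `κ (m ∪ ℓ) ∈ Z ℓ ↔ κ m ∈ Z ℓ`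
    by_cases hm : finrank F (Sel m true) + finrank F (Sel m false) = 1
    · obtain ⟨h1, hbot, hmem, hne, hspan⟩ := hκ1 m hm
      by_cases hdet : κ m ∈ Z ℓ
      · -- undetected generator: both signs rise, total rank three above, `κ (m ∪ ℓ) = 0`
        have hall : ∀ x ∈ Sel m (μof m), x ∈ Z ℓ := fun x hx ↦ by
          obtain ⟨a, rfl⟩ := hspan x hx
          exact Submodule.smul_mem _ a hdet
        have hr1 := hRaise m ℓ (μof m) hℓm hall
        have hr2 := hRaise m ℓ (!μof m) hℓm (hbot_triv m ℓ hm)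
        have hne1 : finrank F (Sel (insert ℓ m) true) + finrank F (Sel (insert ℓ m) false) ≠ 1 := by
          rw [← finrank_add_finrank_not Sel (insert ℓ m) (μof m), hr1, hr2, h1, hbot, finrank_bot]
          omega
        rw [hκ0 _ hne1]
        exact ⟨fun _ ↦ hdet, fun _ ↦ Submodule.zero_mem _⟩
      · -- detected generator: the sign `μ` drops to zero, the sign `¬μ` rises to one above
        obtain ⟨hle, hlow⟩ := hLower m ℓ (μof m) hℓm ⟨κ m, hmem, hdet⟩
        have hr2 := hRaise m ℓ (!μof m) hℓm (hbot_triv m ℓ hm)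
        have h1' : finrank F (Sel (insert ℓ m) true) + finrank F (Sel (insert ℓ m) false) = 1 := by
          rw [← finrank_add_finrank_not Sel (insert ℓ m) (μof m), hr2, hbot, finrank_bot]
          omega
        obtain ⟨h1i, -, hmemi, hnei, -⟩ := hκ1 _ h1'
        have hμi : μof (insert ℓ m) = !μof m := by
          refine Bool.eq_not_iff.mpr fun heq ↦ ?_
          rw [heq] at h1i
          omega
        rw [hμi] at hmemi
        have hnot : κ (insert ℓ m) ∉ Z ℓ := fun hz ↦ by
          have hin : κ (insert ℓ m) ∈ Sel m (!μof m) := hOut m ℓ (!μof m) hℓm _ hmemi hz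
          rw [hbot] at hin
          exact hnei ((Submodule.mem_bot F).mp hin)
        exact ⟨fun h ↦ absurd h hnot, fun h ↦ absurd h hdet⟩
    · -- total rank `≠ 1` below: `κ m = 0`, and a rank-one generator above is forced into `Z ℓ`
      rw [hκ0 m hm]
      refine ⟨fun _ ↦ Submodule.zero_mem _, fun _ ↦ ?_⟩
      by_cases hm' : finrank F (Sel (insert ℓ m) true) + finrank F (Sel (insert ℓ m) false) = 1
      · obtain ⟨h1i, hboti, hmemi, -, -⟩ := hκ1 _ hm'
        by_cases hdet : ∃ x ∈ Sel m (μof (insert ℓ m)), x ∉ Z ℓ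
        · exact (hLower m ℓ _ hℓm hdet).1 hmemi
        · push Not at hdet
          have hr := hRaise m ℓ _ hℓm hdet
          have h0 : finrank F (Sel (insert ℓ m) (!μof (insert ℓ m))) = 0 := by rw [hboti, finrank_bot]
          exfalso
          by_cases hdet' : ∃ x ∈ Sel m (!μof (insert ℓ m)), x ∉ Z ℓ
          · have hl := (hLower m ℓ _ hℓm hdet').2
            apply hm
            rw [← finrank_add_finrank_not Sel m (μof (insert ℓ m))]
            omega
          · push Not at hdet'
            have hr' := hRaise m ℓ _ hℓm hdet'
            omega
      · rw [hκ0 _ hm']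
        exact Submodule.zero_mem _

end Summit.BirchSwinnertonDyer.BirchSwinnertonDyer.Theorems.AdditiveKoly.Synthetic

end
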